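/-
Copyright: lit-balaban Phase-2 proof seat p33 (gen 5).  Statement-level skeleton of a published paper; no proof claims beyond what
the kernel checks below.
-/
import Literature.MathematicalPhysics.QuantumFieldTheory.BalabanImbrieJaffe1984to88.BIJ85Thm711ConfigSpace
import Literature.MathematicalPhysics.QuantumFieldTheory.BalabanImbrieJaffe1984to88.BIJ85SigmaVariational
import Literature.MathematicalPhysics.QuantumFieldTheory.BalabanImbrieJaffe1984to88.BIJ85SigmaTorusScaling
import Literature.MathematicalPhysics.QuantumFieldTheory.BalabanImbrieJaffe1984to88.BIJ85Thm711TorusTransport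
import Literature.MathematicalPhysics.QuantumFieldTheory.BalabanImbrieJaffe1984to88.BIJ85Ineq423Torus

/-!
# `BalabanImbrieJaffe1984to88.BIJ85Thm711Torus` — T. Bałaban, J. Imbrie, A. Jaffe, *Renormalization of the Higgs model:
minimizers, propagators and the stability of mean field theory*, Commun. Math. Phys. **97** (1985) 299–329 [BalabanImbrieJaffe1985]:
**THEOREM 7.1.1 p. 321 FOR THE TORUS σ_k OF (4.2.1)–(4.2.2)** (`BIJ85Sigma421Torus.sigmaTorus`, the `Setup` carriers of the series)
**WITH THE k-UNIFORM CONSTANT**: `2·c(d)·‖f‖² ≤ ⟨f, σ_kf⟩` for every `k ≤ m + K`, every unit-lattice plaquette field `f`, every curl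
normalization — by TRANSPORTING seat p10's configuration-space Theorem 7.1.1 (`BIJ85Thm711ConfigSpace.thm711_configSpace`, the `Tor`
carriers, odd block size) along seat p16's carrier identification `T^{(0)} ≃ Tor (fine (L^k) Mk)` (`B5Eq117TorusCarriers.EK`)

statement-level skeleton of published theorems with citation tags; proofs where landed; nothing here is a claim about the Yang–Mills mass gap

PDF held: `paper:balaban1985-cmp97-bij-higgs-minimizers` (journal page = PDF page + 298).  Pages read as images: p. 305 [PDF 7]
(`HOME/lit-balaban-r15/pages/1985-cmp97-bij-higgs-minimizers-p007-x2.png`), p. 310 [PDF 12], pp. 321–322, 324 [PDF 23–24, 26].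

CITATION HEADER (lean-in-tree rule).  Part of the lit-balaban TYPED SKELETON (HOME `run/shared/lean/pub/lit-balaban/`), Phase-2 seat
p33 (gen 5), unit `lit-balaban-p33`; row **C1.Thm7.1.1** of `HOME/SKELETON.md` (owner r15, referee ref-5), whose state of the head
(`HOME/lit-balaban-r15/ROWS-C1.md` v1.28–v1.29) reads: *"configuration-space variational Theorem 7.1.1 for odd L … (p254178) …
missing for a `proved` head: … the literal inhabitant `Thm711 (fun k => sigmaTorus …)` still needs the Setup ↔ `Tor (fine n M)`
transport of ∂, Q_k, Q^{e*}_k into p33's `thm711_sigmaTorus_of_variational` (iface-2, in no file)"* — supplied HERE.  Companion of: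
p10 g4 `BIJ85Thm711ConfigSpace` (Theorem 7.1.1 in configuration space on `Tor (fine (2M+1) N)`: `2c(d)Σ|f|² ≤ η^dΣ|(n·curlC A −
edgeAdjC f)|²` for two-forms `f` and `Q_kA = 0`, `c(d) = BIJ85SigmaClosedCube.c711 d`), p16 g3 `B5Eq117TorusCarriers` (`EK`, `blockSiteK`,
`Qk_tV`: (1.18) is ONE operator on the two carriers), p21 `B5TowerOneStroke.cplx_Qk`, p31 g2 `BIJ85Eq224Base0.QestarIter_eq`
(`Q^{e*}_k = (Q^{e*})^k` = the pull-back of the block-size-`L^k` edge geometry), p27 g5 `BIJ85Eq7111EdgeAdjoint.edgeAdjC_mulVec`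
((2.22) composed k times on `Tor`), p30 g5 `BIJ85SigmaTorusScaling.sigmaTorus_indep_c`, and this seat's gen 3–4
`BIJ85Sigma712Torus.plaqEquiv` / `BIJ85SigmaVariational.le_inner_sigmaTorus_iff` (⟨f, σ_kf⟩ = inf over `Q_kA = 0` of
‖∂A − Q^{e*}_kf‖²_η, δ_{k,Ax} removed).

THE PRINTED TEXT (verbatim).  p. 321 [PDF 23]: *"7.1. Positivity of σ_k.  Theorem 7.1.1. There exists a constant c > 0, independent
of k, such that c ≤ σ_k. (7.1.1)"*; p. 310 [PDF 12]: *"exp(−½⟨f, σ_kf⟩) = Z_{k,Ax}^{−1}∫𝒟Aδ(Q_kA)δ_{k,Ax}(A)exp(−½‖∂A − Q^{e*}_kf‖²).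
(4.2.1) … Using that representation we also establish a uniform, positive lower bound 0 < c ≦ σ_k. (4.2.3)"*; p. 305 [PDF 7]:
*"(Q^{e*}f)(p) = L²f(p′) if p ∈ B^e(p′), 0 otherwise. (2.22) … Especially important are Q^e_k ≡ (Q^e)^k and Q^s_k = (Q^s)^k"*;
[Balaban1984PropagatorsI] (1.18) p. 20: *"(Q_kA)_b = Σ_{x∈B^k(b₋)} η^{d+1}A([x, x(b)])"*.

WHAT IS PROVED (0 `sorry`, standard axioms; THEOREMS plus the two packagings `sigmaFormTorus` (r15's `SigmaForm` carrier of the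
torus σ_k) and `paramsK` (the k-step parameters) WITH BODIES — no `def … : Prop`, no new named fact, D-0026).  File 2 of 2; file 1 =
`BIJ85Thm711TorusTransport` (the dictionaries `QvOp_AC`, `curlC_AC`, `edgeAdjC_fC`, two-form bookkeeping `asym`/`fC`/`gC`):
* §1′ `QvOp_AC_eq_zero_iff` (`Q_kA = 0` agrees on the two carriers) and **`energy_transport`** (the exponent of (4.2.1):
  `n·curlC (AC A) − edgeAdjC (fC f) = gC (∂_{η⁻¹}A − Q^{e*}_kf)`, `n = L^k = η⁻¹`);
* §2 `thm711_configSpace_odd` (p10's theorem re-indexed by any odd block size), **`variational_bound`** (`2c(d)‖f‖² ≤ ‖√η^d·∂_{η⁻¹}A −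
  √η^d·Q^{e*}_kf‖²` for all `Q_kA = 0`, from p10's theorem at `n = L^k = 2M + 1` — `L` is odd in `Setup` — both sides acquiring the
  two-form factor 2), **`thm711_sigmaTorus`** (`2·c711 d·‖f‖² ≤ ⟪f, sigmaTorus hd (η^d) c k f⟫` for every `k ≤ m + K`, every `f`, every
  `c ≠ 0` via p30's `sigmaTorus_indep_c`, `η = L^{−k}`; the constant depends on `d` only), `thm711_sigmaTorus_exists` (`∃ c > 0` chosen
  before the torus and before `k`), `variational_bound_anyC` + **`thm711_sigmaTorus_range`** (= gen 4's `thm711_sigmaTorus_of_variational`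
  with `w_k = η_k^d` fed with the transported bound — the composition named in ROWS-C1), and the INHABITANTS of r15's `BIJ85Sect7Statements.Thm711`: **`thm711_torusFamily`** — the family
  `k ↦ σ_k` of the tori with `k` renormalization steps (`paramsK P k`: unit lattice `T₁^{(k)}` of side `2L^m` fixed, `T_η` of side
  `2L^{m+k}`, `η = L^{−k}`; every `k : ℕ` is in range) — and `thm711_torusRange` (one `Setup` torus, levels `min k (m + K)`).
HONEST SCOPE.  Even block sizes do not occur in `Setup` (`Params.hL : Odd L`), so nothing is lost against p10's odd-`n` hypothesis; the
constant `2·c711 d` is p10's (Prop. 7.1.2 route), not the paper's unspecified `c`; the Gaussian-integral DEFINITION (4.2.1) of σ_k enters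
through p09/p30's `sigmaTorus` = (4.2.2) at the torus data (`isSigmaForm_sigmaTorus`), as in gen 4.
Unit `lit-balaban-p33` (literature-prover-lit-balaban-p33-g5-0), 2026-08-21.
-/

open scoped BigOperators RealInnerProductSpace Matrix

namespace Literature.MathematicalPhysics.QuantumFieldTheory.BalabanImbrieJaffe1984to88.BIJ85Thm711Torus

open Literature.MathematicalPhysics.QuantumFieldTheory.Balaban1983to89
open LatticeFieldCalculus (curl bondAvgIter)
open BIJ85Eq531Inputs (QestarIter)
open B5Prop11Plancherel (Tor fine)
open B5Block118 (QvOp)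
open B5Eq117TorusCarriers (Mk)
open BIJ85Eq715ConfigSymbols (curlC)
open BIJ85Eq7111EdgeAdjoint (edgeAdjC)
open BIJ85SigmaClosedCube (c711 c711_pos)
open BIJ85Thm711ConfigSpace (thm711_configSpace)
open BIJ85Thm711TorusTransport
open BIJ85Prop511GaugeRG (torusGaugeRG)
open BIJ85Ineq423Torus (norm_toU_sq)
open BIJ85AxialPropagator411 BIJ85SigmaForm421 BIJ85Sigma421Torus BIJ85SigmaVariational BIJ85SigmaTorusScaling BIJ85Sect7Statements

noncomputable section

variable {P : Params} {k : ℕ}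

/-! ## §1′  Two more dictionary entries (file 1's `QvOp_AC`, `curlC_AC`, `edgeAdjC_fC` combined) -/

/-- `Q_kA = 0` on the `Tor` carrier iff `Q_kA = 0` on the `Setup` carrier. [cite: Balaban1984PropagatorsI, (1.18) p.20] -/
theorem QvOp_AC_eq_zero_iff (hk : k ≤ P.m + P.K) (A : VecField P 0 ℝ) :
    QvOp (P.L ^ k) (Mk P k) *ᵥ AC hk A = 0 ↔ bondAvgIter k A = 0 := by
  rw [QvOp_AC]
  constructor
  · intro h
    funext b
    have hb := congrFun h (b.src, b.dir)
    simpa using hb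
  · intro h
    funext i
    simp [h]

/-- `∂_c = c·∂_1` (the lattice factor is a scalar). [cite: Balaban1984PropagatorsI, (1.2) p.18] -/
private theorem curl_eq_mul_curl_one (c : ℝ) (A : VecField P 0 ℝ) (p : Plaq P 0) : curl c A p = c * curl 1 A p := by
  simp only [curl, smul_eq_mul, one_mul]

/-- **The exponent of (4.2.1) transported**: `n·curlC (AC A) − edgeAdjC (fC f) = gC (∂_{η⁻¹}A − Q^{e*}_kf)`, `n = L^k = η⁻¹`
(standing range, `2 ≤ d`). [cite: BalabanImbrieJaffe1985, (4.2.1) p.310] -/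
theorem energy_transport (hd : 2 ≤ P.d) (hk : k ≤ P.m + P.K) (f : Plaq P k → ℝ) (A : VecField P 0 ℝ) :
    (((P.L ^ k : ℕ) : ℂ) • (curlC (fine (P.L ^ k) (Mk P k)) *ᵥ AC hk A) - edgeAdjC (P.L ^ k) (Mk P k) *ᵥ fC k f)
      = gC hk (fun p => curl ((P.L : ℝ) ^ k) A p - QestarIter hd k f p) := by
  rw [curlC_AC, edgeAdjC_fC hd hk]
  funext i
  rw [Pi.sub_apply, Pi.smul_apply, smul_eq_mul, gC, gC, gC, ← asym_smul_sub]
  congr 1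
  funext b
  push_cast
  rw [curl_eq_mul_curl_one ((P.L : ℝ) ^ k)]
  push_cast
  ring

/-! ## §2  Theorem 7.1.1 for the torus σ_k with the k-uniform constant -/

/-- p10's Theorem 7.1.1 in configuration space, re-indexed by an arbitrary ODD block size `n` (p10 states it at `n = 2M + 1`).
[cite: BalabanImbrieJaffe1985, Thm. 7.1.1 p.321] -/
theorem thm711_configSpace_odd {d : ℕ} (hd : 0 < d) {n : ℕ} [NeZero n] (hn : Odd n) {N : Fin d → ℕ} [∀ μ, NeZero (N μ)]
    (f : Tor N × (Fin d × Fin d) → ℂ) (hf : ∀ x μ ν, f (x, (ν, μ)) = -f (x, (μ, ν)))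
    (A : Tor (fine n N) × Fin d → ℂ) (hA : QvOp n N *ᵥ A = 0) :
    2 * c711 d * ∑ a, ‖f a‖ ^ 2 ≤ (((n : ℕ) : ℝ) ^ d)⁻¹ * ∑ b, ‖(((n : ℕ) : ℂ) • (curlC (fine n N) *ᵥ A) - edgeAdjC n N *ᵥ f) b‖ ^ 2 := by
  obtain ⟨M, rfl⟩ := hn
  exact thm711_configSpace hd M f hf A hA

/-- `η^d = (L^k)^{−d}` for `Setup`'s bookkeeping real `η = L^{−k}`. [cite: Balaban1987RG1, (1.1) p.260] -/
theorem eta_pow_d (P : Params) (k : ℕ) : P.eta k ^ P.d = ((((P.L ^ k : ℕ) : ℝ)) ^ P.d)⁻¹ := by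
  simp only [Params.eta, inv_pow, Nat.cast_pow]

/-- `η^d > 0`. [cite: Balaban1987RG1, (1.1) p.260] -/
theorem eta_pow_d_pos (P : Params) (k : ℕ) : 0 < P.eta k ^ P.d := by
  rw [eta_pow_d]
  have : (0 : ℝ) < ((P.L ^ k : ℕ) : ℝ) := by exact_mod_cast pow_pos P.L_pos k
  positivity

/-- **THE VARIATIONAL BOUND ON THE TORUS, k-UNIFORM**: for every `k ≤ m + K`, every unit plaquette field `f` and every η-bond field `A`
with `Q_kA = 0`, `2·c711(d)·‖f‖² ≤ ‖√η^d·∂_{η⁻¹}A − √η^d·Q^{e*}_kf‖² = Σ_pη^d|(∂A)(p) − (Q^{e*}_kf)(p)|²` — p10's `thm711_configSpace`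
transported along `EK` (§1) with the two-form bookkeeping of §0 (both sides acquire the factor 2). [cite: BalabanImbrieJaffe1985, Thm. 7.1.1 p.321] -/
theorem variational_bound (hd : 2 ≤ P.d) (hk : k ≤ P.m + P.K) (f : UnitPlaqSpace P k) (A : VecField P 0 ℝ)
    (hQ : bondAvgIter k A = 0) :
    2 * c711 P.d * ‖f‖ ^ 2 ≤
      ‖curlOp (P := P) (P.eta k ^ P.d) ((P.L : ℝ) ^ k) (toE P A) - QesOp (P := P) hd (P.eta k ^ P.d) k f‖ ^ 2 := by
  have hd0 : 0 < P.d := by omega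
  have hA : QvOp (P.L ^ k) (Mk P k) *ᵥ AC hk A = 0 := (QvOp_AC_eq_zero_iff hk A).2 hQ
  have h := thm711_configSpace_odd hd0 (P.hL.1.pow) (fC k fun q => f q) (fun x μ ν => fC_antisymm _ x μ ν) (AC hk A) hA
  rw [energy_transport hd hk, sum_norm_sq_fC, sum_norm_sq_gC hk, ← eta_pow_d] at h
  rw [energy_eq_sum hd (eta_pow_d_pos P k).le _ k A f, EuclideanSpace.norm_sq_eq]
  have hf : ∑ p : Plaq P k, ‖f p‖ ^ 2 = ∑ p : Plaq P k, f p ^ 2 :=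
    Finset.sum_congr rfl fun p _ => by rw [Real.norm_eq_abs, sq_abs]
  rw [hf, ← Finset.mul_sum]
  linarith

/-- **THEOREM 7.1.1 FOR THE TORUS σ_k** (*"There exists a constant c > 0, independent of k, such that c ≤ σ_k (7.1.1)"*): for the σ_k of
(4.2.1)–(4.2.2) on the tori of `Setup` in the physical normalization (η-lattice norm (2.20), weight `η^d`, `η = L^{−k}`; ANY curl factor
`c ≠ 0`, p30's `sigmaTorus_indep_c`), **`2·c711(d)·‖f‖² ≤ ⟨f, σ_kf⟩` for every `k ≤ m + K` and every unit-lattice plaquette field `f`** —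
the constant depends on the dimension only. [cite: BalabanImbrieJaffe1985, Thm. 7.1.1 (7.1.1) p.321] -/
theorem thm711_sigmaTorus (hd : 2 ≤ P.d) (hk : k ≤ P.m + P.K) {c : ℝ} (hc : c ≠ 0) (f : UnitPlaqSpace P k) :
    2 * c711 P.d * ‖f‖ ^ 2 ≤ ⟪f, sigmaTorus (P := P) hd (P.eta k ^ P.d) c k f⟫ := by
  have hw := eta_pow_d_pos P k
  have hL : ((P.L : ℝ) ^ k) ≠ 0 := pow_ne_zero _ (Nat.cast_ne_zero.2 P.L_pos.ne')
  rw [sigmaTorus_indep_c hd hk hw hc hL]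
  exact (le_inner_sigmaTorus_iff hd hk hw hL f _).2 fun A hQ => variational_bound hd hk f A hQ

/-- The same, packaged as in print with the constant existentially quantified BEFORE `k` (and before the torus): `∃ c > 0` (depending on
`d` only) with `c‖f‖² ≤ ⟨f, σ_kf⟩` for every `k ≤ m + K`, every curl factor and every `f`. [cite: BalabanImbrieJaffe1985, Thm. 7.1.1 (7.1.1) p.321] -/
theorem thm711_sigmaTorus_exists {d : ℕ} (hd2 : 2 ≤ d) :
    ∃ c₀ : ℝ, 0 < c₀ ∧ ∀ (P : Params) (hd : 2 ≤ P.d), P.d = d → ∀ (k : ℕ), k ≤ P.m + P.K → ∀ (c : ℝ), c ≠ 0 →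
      ∀ f : UnitPlaqSpace P k, c₀ * ‖f‖ ^ 2 ≤ ⟪f, sigmaTorus (P := P) hd (P.eta k ^ P.d) c k f⟫ := by
  refine ⟨2 * c711 d, by have := c711_pos (show 0 < d by omega); positivity, ?_⟩
  rintro P hd rfl k hk c hc f
  exact thm711_sigmaTorus hd hk hc f

/-- **The variational bound at ANY curl factor `c ≠ 0`** (the `{Q_kA = 0}`-infimum of `‖√η^d·c∂₁A − √η^d·Q^{e*}_kf‖²` does not
depend on `c`: rescale `A`; here read off `thm711_sigmaTorus` and gen 4's `inner_sigmaTorus_le_energy`). [cite: BalabanImbrieJaffe1985, (4.2.1) p.310] -/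
theorem variational_bound_anyC (hd : 2 ≤ P.d) (hk : k ≤ P.m + P.K) {c : ℝ} (hc : c ≠ 0) (f : UnitPlaqSpace P k)
    (A : VecField P 0 ℝ) (hQ : bondAvgIter k A = 0) :
    2 * c711 P.d * ‖f‖ ^ 2 ≤ ‖curlOp (P := P) (P.eta k ^ P.d) c (toE P A) - QesOp (P := P) hd (P.eta k ^ P.d) k f‖ ^ 2 :=
  (thm711_sigmaTorus hd hk hc f).trans (inner_sigmaTorus_le_energy hd hk (eta_pow_d_pos P k) hc f A hQ)

/-- **The composition named by the row** (ROWS-C1 C1.Thm7.1.1: *"transport … into p33's `thm711_sigmaTorus_of_variational`"*): gen 4's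
`thm711_sigmaTorus_of_variational` with the weight family `w_k = η_k^d = L^{−kd}` and a fixed curl factor, fed with the transported
variational bound — the standing-range form of Theorem 7.1.1 on ONE torus with the k-uniform constant `2·c711 d`.
[cite: BalabanImbrieJaffe1985, Thm. 7.1.1 (7.1.1) p.321] -/
theorem thm711_sigmaTorus_range (hd : 2 ≤ P.d) {c : ℝ} (hc : c ≠ 0) :
    ∀ k, k ≤ P.m + P.K → ∀ f : UnitPlaqSpace P k, 2 * c711 P.d * ‖f‖ ^ 2 ≤ ⟪f, sigmaTorus (P := P) hd (P.eta k ^ P.d) c k f⟫ :=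
  thm711_sigmaTorus_of_variational hd (fun k => P.eta k ^ P.d) (eta_pow_d_pos P) hc fun _ hk f A hQ =>
    variational_bound_anyC hd hk hc f A hQ

/-! ### The `Thm711` inhabitants (r15's `BIJ85Sect7Statements.Thm711`) -/

/-- The carrier of r15's `SigmaForm` at scale `k` for the torus σ_k: unit-lattice plaquette fields of `T₁^{(k)}` with `‖f‖²` and
`⟨f, σ_kf⟩` (weight `η^d`, curl factor `η⁻¹ = L^k`). [cite: BalabanImbrieJaffe1985, (7.1.1) p.321] -/
def sigmaFormTorus (P : Params) (hd : 2 ≤ P.d) (k : ℕ) : SigmaForm where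
  Plaq := UnitPlaqSpace P k
  normSq f := ‖f‖ ^ 2
  sigma f := ⟪f, sigmaTorus (P := P) hd (P.eta k ^ P.d) ((P.L : ℝ) ^ k) k f⟫

/-- The parameters of the torus with `k` renormalization steps behind it: same `d`, `L`, `m`, and `K := k` — unit lattice `T₁^{(k)}` of
side `2L^m` (fixed), finest lattice `T_η` of side `2L^{m+k}`, `η = L^{−k}` (the setting of Sect. 4: the current lattice is the unit
lattice). [cite: BalabanImbrieJaffe1985, (4.1.1) p.309] -/
def paramsK (P : Params) (k : ℕ) : Params := ⟨P.d, P.L, P.m, k, P.hd, P.hL⟩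

/-- `paramsK` keeps the dimension. [cite: BalabanImbrieJaffe1985, (4.1.1) p.309] -/
@[simp] theorem paramsK_d (P : Params) (k : ℕ) : (paramsK P k).d = P.d := rfl

/-- every `k` is in the standing range of `paramsK P k` (`k ≤ m + k`). [cite: BalabanImbrieJaffe1985, (4.1.1) p.309] -/
theorem le_paramsK_range (P : Params) (k : ℕ) : k ≤ (paramsK P k).m + (paramsK P k).K := Nat.le_add_left k P.m


/-- **THEOREM 7.1.1 AS AN INHABITANT OF r15's `Thm711`** for the torus family `k ↦ σ_k` (k steps, `η = L^{−k}`, unit-lattice volume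
`(2L^m)^d` fixed): `∃ c > 0, ∀ k, ∀ f, c‖f‖² ≤ ⟨f, σ_kf⟩`. [cite: BalabanImbrieJaffe1985, Thm. 7.1.1 (7.1.1) p.321] -/
theorem thm711_torusFamily (P : Params) (hd : 2 ≤ P.d) :
    Thm711 (fun k => sigmaFormTorus (paramsK P k) hd k) := by
  refine ⟨2 * c711 P.d, by have := c711_pos (show 0 < P.d by omega); positivity, fun k f => ?_⟩
  exact thm711_sigmaTorus (P := paramsK P k) hd (le_paramsK_range P k) (pow_ne_zero _ (Nat.cast_ne_zero.2 P.L_pos.ne')) f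

/-- The fixed-torus family over the standing range, as a `Thm711` inhabitant: `k ↦ σ_{min k (m+K)}` on ONE `Setup` torus (levels
beyond the coarsest torus repeat the last one). [cite: BalabanImbrieJaffe1985, Thm. 7.1.1 (7.1.1) p.321] -/
theorem thm711_torusRange (P : Params) (hd : 2 ≤ P.d) :
    Thm711 (fun k => sigmaFormTorus P hd (min k (P.m + P.K))) := by
  refine ⟨2 * c711 P.d, by have := c711_pos (show 0 < P.d by omega); positivity, fun k f => ?_⟩
  exact thm711_sigmaTorus hd (min_le_right k _) (pow_ne_zero _ (Nat.cast_ne_zero.2 P.L_pos.ne')) f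

/-! ## §3  (4.2.3) *"a uniform, positive lower bound 0 < c ≦ σ_k"* at every weight; r15's `GaugeRG.Ineq423` at the torus instance -/

/-- `1 ≤ L^{kd}` read in `ℝ`. [cite: Balaban1987RG1, (0.1) p.251] -/
private theorem one_le_Lkd (P : Params) (k : ℕ) : (1 : ℝ) ≤ (((P.L ^ k : ℕ) : ℝ)) ^ P.d := by
  have h1 : (1 : ℝ) ≤ ((P.L ^ k : ℕ) : ℝ) := by exact_mod_cast Nat.one_le_iff_ne_zero.mpr (pow_ne_zero k P.L_pos.ne')
  exact one_le_pow₀ h1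

/-- **Theorem 7.1.1 at an arbitrary weight `w > 0`**: `2·c711(d)·w·L^{kd}·‖f‖² ≤ ⟨f, σ_k^{(w)}f⟩` for every `k ≤ m + K`, `c ≠ 0`, `f` —
σ_k is linear in the weight (p30's `inner_sigmaTorus_scale_w`) and `w = (w·L^{kd})·η^d`. [cite: BalabanImbrieJaffe1985, (4.2.3) p.310] -/
theorem thm711_sigmaTorus_weight (hd : 2 ≤ P.d) (hk : k ≤ P.m + P.K) {w : ℝ} (hw : 0 < w) {c : ℝ} (hc : c ≠ 0)
    (f : UnitPlaqSpace P k) :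
    2 * c711 P.d * (w * (((P.L ^ k : ℕ) : ℝ)) ^ P.d) * ‖f‖ ^ 2 ≤ ⟪f, sigmaTorus (P := P) hd w c k f⟫ := by
  have hη := eta_pow_d_pos P k
  have hLd : (0 : ℝ) < (((P.L ^ k : ℕ) : ℝ)) ^ P.d := lt_of_lt_of_le one_pos (one_le_Lkd P k)
  have ha : 0 < w * (((P.L ^ k : ℕ) : ℝ)) ^ P.d := mul_pos hw hLd
  have hw' : w * (((P.L ^ k : ℕ) : ℝ)) ^ P.d * P.eta k ^ P.d = w := by
    rw [eta_pow_d, mul_assoc, mul_inv_cancel₀ hLd.ne', mul_one]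
  have key : ⟪f, sigmaTorus (P := P) hd w c k f⟫ =
      w * (((P.L ^ k : ℕ) : ℝ)) ^ P.d * ⟪f, sigmaTorus (P := P) hd (P.eta k ^ P.d) c k f⟫ := by
    rw [← inner_sigmaTorus_scale_w hd hk ha hη hc hc f f, hw']
  rw [key]
  calc 2 * c711 P.d * (w * (((P.L ^ k : ℕ) : ℝ)) ^ P.d) * ‖f‖ ^ 2
        = w * (((P.L ^ k : ℕ) : ℝ)) ^ P.d * (2 * c711 P.d * ‖f‖ ^ 2) := by ring
    _ ≤ w * (((P.L ^ k : ℕ) : ℝ)) ^ P.d * ⟪f, sigmaTorus (P := P) hd (P.eta k ^ P.d) c k f⟫ :=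
        mul_le_mul_of_nonneg_left (thm711_sigmaTorus hd hk hc f) ha.le

/-- **(4.2.3) *"a uniform, positive lower bound 0 < c ≦ σ_k"* AT EVERY FIXED WEIGHT `w > 0`**: `2·c711(d)·w·‖f‖² ≤ ⟨f, σ_k^{(w)}f⟩` for
all `k ≤ m + K`, all `c ≠ 0`, all `f` (`L^{kd} ≥ 1`) — the constant is uniform in `k` and in the torus. [cite: BalabanImbrieJaffe1985, (4.2.3) p.310] -/
theorem ineq423_uniform (hd : 2 ≤ P.d) (hk : k ≤ P.m + P.K) {w : ℝ} (hw : 0 < w) {c : ℝ} (hc : c ≠ 0) (f : UnitPlaqSpace P k) :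
    2 * c711 P.d * w * ‖f‖ ^ 2 ≤ ⟪f, sigmaTorus (P := P) hd w c k f⟫ := by
  refine le_trans ?_ (thm711_sigmaTorus_weight hd hk hw hc f)
  have h0 : 0 ≤ 2 * c711 P.d * w * ‖f‖ ^ 2 := by
    have := c711_pos (show 0 < P.d by omega)
    positivity
  calc 2 * c711 P.d * w * ‖f‖ ^ 2 = 2 * c711 P.d * w * ‖f‖ ^ 2 * 1 := (mul_one _).symm
    _ ≤ 2 * c711 P.d * w * ‖f‖ ^ 2 * (((P.L ^ k : ℕ) : ℝ)) ^ P.d := mul_le_mul_of_nonneg_left (one_le_Lkd P k) h0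
    _ = 2 * c711 P.d * (w * (((P.L ^ k : ℕ) : ℝ)) ^ P.d) * ‖f‖ ^ 2 := by ring

/-- **r15's decl of record `GaugeRG.Ineq423 c` AT THE TORUS INSTANCE WITH THE UNIFORM CONSTANT `c = 2·c711(d)·w`** — the same `c` for
every `k ≤ m + K` and every torus of the series in dimension `d` (gen 2's `BIJ85Ineq423Torus.ineq423_torusGaugeRG` had a per-torus,
per-`k` constant from compactness; row C1.Eq4.2.3). [cite: BalabanImbrieJaffe1985, (4.2.3) p.310] -/
theorem ineq423_torusGaugeRG_uniform (hd : 2 ≤ P.d) (hk : k ≤ P.m + P.K) {w : ℝ} (hw : 0 < w)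
    (distU Ck : PBond P k → PBond P k → ℝ) (normCk : ℝ) :
    (torusGaugeRG P hd k w distU Ck normCk).Ineq423 (2 * c711 P.d * w) := by
  refine ⟨by have := c711_pos (show 0 < P.d by omega); positivity, fun f => ?_⟩
  show 2 * c711 P.d * w * ∑ p, f p * f p ≤ ⟪toU P k f, sigmaTorus (P := P) hd w ((P.L : ℝ) ^ k) k (toU P k f)⟫
  rw [← norm_toU_sq]
  exact ineq423_uniform hd hk hw (pow_ne_zero _ (Nat.cast_ne_zero.2 P.L_pos.ne')) (toU P k f)

/-- … and for the action Δ_k DEFINED by (4.3.1) (r15's `GaugeRG.DeltaForm B B = ⟨∂B, σ_k∂B⟩`): `2·c711(d)·w·Σ_p|(∂B)(p)|² ≤ ⟨B, Δ_kB⟩`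
uniformly in `k ≤ m + K`. [cite: BalabanImbrieJaffe1985, (4.3.1) p.311] -/
theorem deltaForm_torusGaugeRG_ge_uniform (hd : 2 ≤ P.d) (hk : k ≤ P.m + P.K) {w : ℝ} (hw : 0 < w)
    (distU Ck : PBond P k → PBond P k → ℝ) (normCk : ℝ) (B : PBond P k → ℝ) :
    2 * c711 P.d * w * ∑ p, curl 1 B p * curl 1 B p ≤ (torusGaugeRG P hd k w distU Ck normCk).DeltaForm B B :=
  (ineq423_torusGaugeRG_uniform hd hk hw distU Ck normCk).2 (curl 1 B)

end

end Literature.MathematicalPhysics.QuantumFieldTheory.BalabanImbrieJaffe1984to88.BIJ85Thm711Torus
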